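import Summits.HodgeConjecture.CorCM.WeilFourfoldOfMarkman
import Summits.HodgeConjecture.CorCM.AndreProductFormBiproduct
import Literature.AlgebraicGeometry.HodgeTheory.WeilTypeHodgeRing
import Literature.AlgebraicGeometry.HodgeTheory.WeilClassesHodgeType
import HarnessLib

/-!
# COR-CM — the Weil fourfold `B ⊞ E`: Weil type from the CM types, and the WHOLE Weil plane is algebraic (mod Markman)

HONEST FRAMING (cell `pub-hodgecm2` / COR-CM, seat b24 gen 9; COUNT-NEUTRAL — no binder row of
`HOME/BINDER-OWNERS.md` is touched and no case of the Hodge conjecture is proved: every algebraicity statement is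
CONDITIONAL on the displayed named fact `HodgeTheory.Markman2025_weilClasses_algebraic_abelianFourfold`, the
B2b-ladder floor R1).  Sequel of `CorCM/WeilFourfoldOfMarkman.lean` (step L3 of
`HOME/pub-hodgecm2-lit-andre-3/A1-BLUEPRINT.md`), supplying the input the pull-back step L5 consumes.

Markman's record is POINTWISE (a RATIONAL `(2,2)` class in the Weil plane `weilClassesOf Y φ 2 d = E₊ ⊔ E₋` of an
abelian fourfold is algebraic); the A1 line pulls back the NON-rational generators `w_τ ∈ E_±` of the plane of
`Y = B ⊞ E`, so it needs the WHOLE complex plane inside the `ℂ`-subspace `algebraicClasses Y.X 2`.  The tree reduces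
this to Weil type (`IsWeilType.weilClassesOf_le_algebraicClasses`, van Geemen 4.9), and Weil type follows from ONE
non-zero `(2,2)` class in the plane (`isWeilType_of_weilClass_ne_zero`, Deligne–Milne Prop. 4.4), produced here as
a cup product of four `i√d`-eigenvectors of `φ^*` on `H¹(Y)`: `cupPowOne_mem_weilClassesPlus` (cup products of
`i√d`-eigenvectors lie in `E₊`), `isWeilType_of_cupPowOne` / `weilClassesOf_le_algebraicClasses_of_cupPowOne`
(`2m` independent eigenvectors with types summing to `(m,m)` give Weil type, and pointwise algebraicity upgrades to
the whole plane), `card_filter_comp_eq_three` (a complex embedding of a quadratic `k` has three extensions to a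
sextic `K` along `i : k → K`), and `isWeilType_cmThreefold_biprod_cmCurve` /
`weilClassesOf_le_algebraicClasses_cmThreefold_biprod_cmCurve`: for realisations `B ⊨ (K; Ψ)` (`[K:ℚ] = 6`),
`E ⊨ (k; Φ₀)` (`[k:ℚ] = 2`), `δ ∈ 𝓞_k` with `δ² = -d`, `0 < d`, `φ_Y = ι_B(i δ) ⊕ ι_E(δ)` on `Y = B ⊞ E`, the TYPE
COUNT `#{s ∈ Ψ : s ∘ i = τ} + [τ ∈ Φ₀] = 2` (all `τ : k → ℂ`) gives Weil type `(2, d)` and — given Markman's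
theorem — an algebraic Weil plane.

THEOREMS ONLY; no `sorry`; axioms `propext`, `Classical.choice`, `Quot.sound`.  NOT here: twist isogenies, face
monomials, pull-backs, or any statement about `weilLineClasses` (A1 steps L2/L4/L5/L6, other seats).

## References
* [Markman2025SurveySecant] E. Markman, arXiv:2509.23403, Thm. 1.2, §11.5 Step 2 (`HodgeTheory/WeilClassesFourfolds`).
* [vanGeemen1994HodgeAV] B. van Geemen, LNM 1594 (1994), 4.9–4.10, Lemma 5.2, proof of Thm. 6.12.
* [Deligne1982HodgeCycles] P. Deligne (notes by J. S. Milne), LNM 900 (1982), §4 Prop. 4.4, §5 (c).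
-/

noncomputable section

namespace Summit.HodgeConjecture.CorCM.WeilFourfold

open CategoryTheory CategoryTheory.Limits NumberField
open Literature.AlgebraicGeometry Literature.AlgebraicGeometry.Motives Literature.AlgebraicGeometry.HodgeTheory
open Literature.AlgebraicGeometry.ComplexMultiplication (IsCMTypeRealisation)
open Literature.AlgebraicTopology.SingularHomology
open Literature.NumberTheory.Automorphic.PicardCM (eigenline)
open Summit.HodgeConjecture.HodgeConjecture.Theorems.HodgeAbelianVarieties.CMPivotAndre
  (complexBetti_map_map_one_apply complexBetti_map_id_one_apply complexBetti_map_zero_one_apply)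
open Summit.HodgeConjecture.CorCM.AndreProductForm
  (exists_eigenbasis map_ι_apply_of_mem_eigenline isOfHodgeType_oneZero_of_mem isOfHodgeType_zeroOne_of_not_mem)

/-! ## §1 A non-zero `(m,m)` Weil class from `2m` eigenvectors -/

section Eigenvectors

variable {Y : AbelianVariety ℂ} (φ : Y ⟶ Y) {d : ℕ}

/-- **`v₁ ⌣ ⋯ ⌣ v_{2m} ∈ E₊`** for `i√d`-eigenvectors `vᵢ` of `φ^*` on `H¹(Y)`: `(x·𝟙 + y·φ)^*` acts on each `vᵢ`
by `x + y·i√d` (`complexBetti_map_nsmul_id_add_nsmul_one_of_mem_eigenspace`), hence on the cup product by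
`(x + y·i√d)^{2m}` (naturality `complexBetti_map_cupPowOne` and multilinearity).  Van Geemen: "`⋀^{2n} W`" is the
`+`-eigenline. [cite: vanGeemen1994HodgeAV, 4.9 and proof of Thm. 6.12] -/
theorem cupPowOne_mem_weilClassesPlus {m : ℕ} (w : Fin (2 * m) → complexBetti Y.X 1)
    (hw : ∀ j, w j ∈ Module.End.eigenspace (complexBetti.map φ.hom.hom.hom 1).hom
      (Complex.I * (Real.sqrt d : ℂ))) :
    cupPowOne ℂ (ComplexPoints Y.X) (2 * m) w ∈ weilClassesPlus Y φ m d := by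
  rw [mem_weilClassesPlus_iff]
  intro x y
  change complexBetti.map (x • 𝟙 Y + y • φ).hom.hom.hom (2 * m) (cupPowOne ℂ (ComplexPoints Y.X) (2 * m) w) = _
  rw [complexBetti_map_cupPowOne]
  have e : (fun j => complexBetti.map (x • 𝟙 Y + y • φ).hom.hom.hom 1 (w j)) =
      fun j => ((x : ℂ) + (y : ℂ) * (Complex.I * (Real.sqrt d : ℂ))) • w j := by
    funext j
    exact complexBetti_map_nsmul_id_add_nsmul_one_of_mem_eigenspace (hw j) x y
  rw [e, MultilinearMap.map_smul_univ, Finset.prod_const, Finset.card_univ, Fintype.card_fin, ← mul_assoc]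

/-- **Weil type from `2m` independent eigenvectors with types summing to `(m,m)`** (Deligne–Milne Prop. 4.4 (⇒) /
van Geemen 4.10): for an abelian `2m`-fold `Y` (`m ≥ 1`) with `φ ≫ φ = -(d • 𝟙 Y)`, `d ≥ 1`, if
`w₁, …, w_{2m} ∈ H¹(Y)` are linearly independent `i√d`-eigenvectors of `φ^*` of Hodge types `(pⱼ, qⱼ)` with
`Σ pⱼ = m = Σ qⱼ`, then `w₁ ⌣ ⋯ ⌣ w_{2m}` is a non-zero class of type `(m,m)` in the Weil plane
(`cupPowOne_ne_zero_of_linearIndependent`, `isOfHodgeType_cupPowOne`), so `(Y, φ)` is of Weil type `(m, d)`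
(`isWeilType_of_weilClass_ne_zero`). [cite: Deligne1982HodgeCycles, §4 Prop. 4.4] [cite: vanGeemen1994HodgeAV, 4.10] -/
theorem isWeilType_of_cupPowOne {m : ℕ} (hm : 0 < m) (hd : 0 < d) (hY : Y.dim = 2 * m)
    (hφ : φ ≫ φ = -(d • 𝟙 Y)) (w : Fin (2 * m) → complexBetti Y.X 1) (hli : LinearIndependent ℂ w)
    (hw : ∀ j, w j ∈ Module.End.eigenspace (complexBetti.map φ.hom.hom.hom 1).hom
      (Complex.I * (Real.sqrt d : ℂ)))
    (p q : Fin (2 * m) → ℕ) (hpq : ∀ j, IsOfHodgeType (2 * m) Y.X 1 (p j) (q j) (w j))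
    (hp : ∑ j, p j = m) (hq : ∑ j, q j = m) : IsWeilType Y φ m d := by
  have hsp : IsSmoothProjective (2 * m) Y.X := isSmoothProjective_of_dim_eq' hY
  have hH : IsOfHodgeType (2 * m) Y.X (2 * m) m m (cupPowOne ℂ (ComplexPoints Y.X) (2 * m) w) := by
    have h := isOfHodgeType_cupPowOne hsp (by omega) w p q hpq
    rwa [hp, hq] at h
  exact isWeilType_of_weilClass_ne_zero hm hd hY hφ
    (weilClassesPlus_le_weilClassesOf Y φ m d (cupPowOne_mem_weilClassesPlus φ w hw))
    (cupPowOne_ne_zero_of_linearIndependent Y hli) hH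

/-- **Pointwise ⟹ whole plane.** In the situation of `isWeilType_of_cupPowOne`, if every RATIONAL `(m,m)` class of
the Weil plane is algebraic (the shape of `Markman2025_weilClasses_algebraic_abelianFourfold`), the whole complex plane
lies in `algebraicClasses Y.X m` (van Geemen 4.9; tree `IsWeilType.weilClassesOf_le_algebraicClasses`).
[cite: vanGeemen1994HodgeAV, 4.9–4.10 and Lemma 5.2] -/
theorem weilClassesOf_le_algebraicClasses_of_cupPowOne {m : ℕ} (hm : 0 < m) (hd : 0 < d) (hY : Y.dim = 2 * m)
    (hφ : φ ≫ φ = -(d • 𝟙 Y)) (w : Fin (2 * m) → complexBetti Y.X 1) (hli : LinearIndependent ℂ w)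
    (hw : ∀ j, w j ∈ Module.End.eigenspace (complexBetti.map φ.hom.hom.hom 1).hom
      (Complex.I * (Real.sqrt d : ℂ)))
    (p q : Fin (2 * m) → ℕ) (hpq : ∀ j, IsOfHodgeType (2 * m) Y.X 1 (p j) (q j) (w j))
    (hp : ∑ j, p j = m) (hq : ∑ j, q j = m)
    (halg : ∀ c : complexBetti Y.X (2 * m), IsRationalClass c → IsOfHodgeType (2 * m) Y.X (2 * m) m m c →
      c ∈ weilClassesOf Y φ m d → c ∈ algebraicClasses Y.X m) :
    weilClassesOf Y φ m d ≤ algebraicClasses Y.X m :=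
  (isWeilType_of_cupPowOne φ hm hd hY hφ w hli hw p q hpq hp hq).weilClassesOf_le_algebraicClasses
    fun c hcW hcQ hcH => halg c hcQ hcH hcW

end Eigenvectors

/-! ## §2 Extensions of a complex embedding along a degree-three extension of number fields -/

section Fibre

open scoped Classical

variable {K : Type} [Field K] [NumberField K] {k : Type} [Field k] [NumberField k]

/-- **Each complex embedding of `k` has exactly three extensions to `K`** along a ring map `i : k → K` of number
fields of degrees `[k:ℚ] = 2`, `[K:ℚ] = 6`: the extensions of `τ` are the `k`-algebra maps `K →ₐ[k] ℂ` for the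
structures `i`, `τ`, of which there are `[K:k] = 6/2 = 3` (Mathlib `AlgHom.card`, tower law). [folklore] -/
theorem card_filter_comp_eq_three (i : k →+* K) (h6 : Module.finrank ℚ K = 6) (h2 : Module.finrank ℚ k = 2)
    (τ : k →+* ℂ) :
    (Finset.univ.filter fun s : K →+* ℂ => s.comp i = τ).card = 3 := by
  classical
  letI : Algebra k K := i.toAlgebra
  letI : Algebra k ℂ := τ.toAlgebra
  haveI : IsScalarTower ℚ k K := IsScalarTower.of_algebraMap_eq fun q => by
    rw [RingHom.algebraMap_toAlgebra, eq_ratCast, eq_ratCast, map_ratCast]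
  haveI : FiniteDimensional k K := FiniteDimensional.right ℚ k K
  have hkK : Module.finrank k K = 3 := by
    have h := Module.finrank_mul_finrank ℚ k K
    rw [h2, h6] at h
    omega
  -- the extensions of `τ` are the `k`-algebra maps
  have hcomm : ∀ f : K →ₐ[k] ℂ, f.toRingHom.comp i = τ := fun f =>
    RingHom.ext fun x => f.commutes x
  have hcomm' : ∀ s : {s : K →+* ℂ // s.comp i = τ}, ∀ x : k,
      s.1.toFun (algebraMap k K x) = algebraMap k ℂ x := fun s x => RingHom.congr_fun s.2 x
  let eqv : (K →ₐ[k] ℂ) ≃ {s : K →+* ℂ // s.comp i = τ} :=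
    { toFun := fun f => ⟨f.toRingHom, hcomm f⟩
      invFun := fun s => ⟨s.1, hcomm' s⟩
      left_inv := fun f => AlgHom.ext fun x => rfl
      right_inv := fun s => Subtype.ext (RingHom.ext fun x => rfl) }
  rw [← Fintype.card_subtype, ← Fintype.card_congr eqv, AlgHom.card, hkK]

end Fibre

/-! ## §3 The CM fourfold `B ⊞ E`: Weil type from the type count, whole plane algebraic mod Markman -/

section CM

open scoped Classical

variable {K : Type} [Field K] [NumberField K] {k : Type} [Field k] [NumberField k]

/-- `inl^* fst^* = id` on `H¹(B)` (`inl ≫ fst = 𝟙`). [folklore] -/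
theorem map_inl_map_fst {B E : AbelianVariety ℂ} (x : complexBetti B.X 1) :
    complexBetti.map (biprod.inl : B ⟶ B ⊞ E).hom.hom.hom 1
      (complexBetti.map (biprod.fst : B ⊞ E ⟶ B).hom.hom.hom 1 x) = x := by
  rw [complexBetti_map_map_one_apply, biprod.inl_fst, complexBetti_map_id_one_apply]

/-- `inl^* snd^* = 0` on `H¹(E)` (`inl ≫ snd = 0`, and `0^* = 0` on `H¹`). [folklore] -/
theorem map_inl_map_snd {B E : AbelianVariety ℂ} (y : complexBetti E.X 1) :
    complexBetti.map (biprod.inl : B ⟶ B ⊞ E).hom.hom.hom 1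
      (complexBetti.map (biprod.snd : B ⊞ E ⟶ E).hom.hom.hom 1 y) = 0 := by
  rw [complexBetti_map_map_one_apply, biprod.inl_snd, complexBetti_map_zero_one_apply]

/-- `inr^* fst^* = 0` on `H¹(B)`. [folklore] -/
theorem map_inr_map_fst {B E : AbelianVariety ℂ} (x : complexBetti B.X 1) :
    complexBetti.map (biprod.inr : E ⟶ B ⊞ E).hom.hom.hom 1
      (complexBetti.map (biprod.fst : B ⊞ E ⟶ B).hom.hom.hom 1 x) = 0 := by
  rw [complexBetti_map_map_one_apply, biprod.inr_fst, complexBetti_map_zero_one_apply]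

/-- `inr^* snd^* = id` on `H¹(E)`. [folklore] -/
theorem map_inr_map_snd {B E : AbelianVariety ℂ} (y : complexBetti E.X 1) :
    complexBetti.map (biprod.inr : E ⟶ B ⊞ E).hom.hom.hom 1
      (complexBetti.map (biprod.snd : B ⊞ E ⟶ E).hom.hom.hom 1 y) = y := by
  rw [complexBetti_map_map_one_apply, biprod.inr_snd, complexBetti_map_id_one_apply]

/-- `(f ⊕ g)^* fst^* x = fst^* f^* x` on `H¹` (`biprod.map f g ≫ fst = fst ≫ f`). [folklore] -/
theorem map_biprodMap_map_fst {B E : AbelianVariety ℂ} (f : B ⟶ B) (g : E ⟶ E) (x : complexBetti B.X 1) :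
    complexBetti.map (biprod.map f g).hom.hom.hom 1
        (complexBetti.map (biprod.fst : B ⊞ E ⟶ B).hom.hom.hom 1 x) =
      complexBetti.map (biprod.fst : B ⊞ E ⟶ B).hom.hom.hom 1 (complexBetti.map f.hom.hom.hom 1 x) := by
  rw [complexBetti_map_map_one_apply, biprod.map_fst, ← complexBetti_map_map_one_apply]

/-- `(f ⊕ g)^* snd^* y = snd^* g^* y` on `H¹` (`biprod.map f g ≫ snd = snd ≫ g`). [folklore] -/
theorem map_biprodMap_map_snd {B E : AbelianVariety ℂ} (f : B ⟶ B) (g : E ⟶ E) (y : complexBetti E.X 1) :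
    complexBetti.map (biprod.map f g).hom.hom.hom 1
        (complexBetti.map (biprod.snd : B ⊞ E ⟶ E).hom.hom.hom 1 y) =
      complexBetti.map (biprod.snd : B ⊞ E ⟶ E).hom.hom.hom 1 (complexBetti.map g.hom.hom.hom 1 y) := by
  rw [complexBetti_map_map_one_apply, biprod.map_snd, ← complexBetti_map_map_one_apply]

/-- `(i√d)` is fixed by `conj ∘ (-)`: `conj (-(i√d)) = i√d`. [folklore] -/
theorem conj_neg_I_mul_sqrt (d : ℕ) :
    starRingEnd ℂ (-(Complex.I * (Real.sqrt d : ℂ))) = Complex.I * (Real.sqrt d : ℂ) := by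
  rw [map_neg, map_mul, Complex.conj_I, Complex.conj_ofReal, neg_mul, neg_neg]

/-- A complex embedding of `k` with `τ(δ) = i√d`, for `δ ∈ 𝓞_k` with `δ² = -d`: some embedding has
`τ(δ) = ± i√d`, and its complex conjugate has the opposite sign. [folklore] -/
theorem exists_apply_eq_I_mul_sqrt {δ : 𝓞 k} {d : ℕ} (hδ : ((δ : k)) ^ 2 = -(d : k)) :
    ∃ τ : k →+* ℂ, τ (δ : k) = Complex.I * (Real.sqrt d : ℂ) := by
  obtain ⟨τ₀⟩ := (inferInstance : Nonempty (k →+* ℂ))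
  have hsq : (τ₀ (δ : k)) ^ 2 = (Complex.I * (Real.sqrt d : ℂ)) ^ 2 := by
    rw [← map_pow, hδ, map_neg, map_natCast, I_mul_sqrt_sq]
  rcases sq_eq_sq_iff_eq_or_eq_neg.1 hsq with h | h
  · exact ⟨τ₀, h⟩
  · refine ⟨NumberField.ComplexEmbedding.conjugate τ₀, ?_⟩
    rw [NumberField.ComplexEmbedding.conjugate_coe_eq, h, conj_neg_I_mul_sqrt]

/-- **Weil type of the CM fourfold `B ⊞ E` from the TYPE COUNT** (A1-BLUEPRINT step L3; Deligne 1982 §5 (c):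
a sum of CM types with constant total gives Weil type).  For realisations `B ⊨ (K; Ψ)` (`[K:ℚ] = 6`),
`E ⊨ (k; Φ₀)` (`[k:ℚ] = 2`), `i : k →+* K`, `δ ∈ 𝓞_k` with `δ² = -d`, `0 < d`, `φ_Y := ι_B(i δ) ⊕ ι_E(δ)` on
`Y := B ⊞ E`: if `#{s ∈ Ψ : s ∘ i = τ} + [τ ∈ Φ₀] = 2` for every `τ : k → ℂ`, then `(Y, φ_Y)` is of Weil type
`(2, d)` — for `τ₊` with `τ₊(δ) = i√d`, the classes `fst^* v_s` (`s ∘ i = τ₊`) and `snd^* u_{τ₊}` are four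
independent `i√d`-eigenvectors of `φ_Y^*` whose Hodge types sum to `(2,2)` (`isWeilType_of_cupPowOne`).
[cite: Deligne1982HodgeCycles, §5 (c) and §4 Prop. 4.4] [cite: vanGeemen1994HodgeAV, 4.9–4.10] -/
theorem isWeilType_cmThreefold_biprod_cmCurve
    (h6 : Module.finrank ℚ K = 6) (h2 : Module.finrank ℚ k = 2) (i : k →+* K)
    {Ψ : CMType K} {B : AbelianVariety ℂ} {ιB : 𝓞 K →+* End B} {θB : K →+* Module.End ℂ (complexBetti B.X 1)}
    (hB : IsCMTypeRealisation Ψ B ιB θB)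
    {Φ₀ : CMType k} {E : AbelianVariety ℂ} {ιE : 𝓞 k →+* End E} {θE : k →+* Module.End ℂ (complexBetti E.X 1)}
    (hE : IsCMTypeRealisation Φ₀ E ιE θE)
    {δ : 𝓞 k} {d : ℕ} (hd : 0 < d) (hδ : ((δ : k)) ^ 2 = -(d : k))
    (hcount : ∀ τ : k →+* ℂ,
      (Finset.univ.filter fun s : K →+* ℂ => s.comp i = τ ∧ s ∈ Ψ.1).card + (if τ ∈ Φ₀.1 then 1 else 0) = 2) :
    IsWeilType (B ⊞ E) (biprod.map (ιB (RingOfIntegers.mapRingHom i δ)) (ιE δ)) 2 d := by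
  classical
  -- notation
  set δK : 𝓞 K := RingOfIntegers.mapRingHom i δ with hδKdef
  set φY : B ⊞ E ⟶ B ⊞ E := biprod.map (ιB δK) (ιE δ) with hφYdef
  set μ : ℂ := Complex.I * (Real.sqrt d : ℂ) with hμdef
  -- squares
  have hδ𝓞 : δ ^ 2 = -(d : 𝓞 k) := by
    apply RingOfIntegers.ext
    change algebraMap (𝓞 k) k (δ ^ 2) = algebraMap (𝓞 k) k (-(d : 𝓞 k))
    rw [map_pow, map_neg, map_natCast]
    exact hδ
  have hδK : ((δK : K)) ^ 2 = -(d : K) := by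
    rw [hδKdef, RingOfIntegers.mapRingHom_apply, ← map_pow, hδ, map_neg, map_natCast]
  have hδK𝓞 : δK ^ 2 = -(d : 𝓞 K) := by
    apply RingOfIntegers.ext
    change algebraMap (𝓞 K) K (δK ^ 2) = algebraMap (𝓞 K) K (-(d : 𝓞 K))
    rw [map_pow, map_neg, map_natCast]
    exact hδK
  have hφY : φY ≫ φY = -(d • 𝟙 (B ⊞ E)) :=
    biprod_map_comp_self_eq_neg (comp_self_eq_neg_of_sq_eq_neg ιB hδK𝓞) (comp_self_eq_neg_of_sq_eq_neg ιE hδ𝓞)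
  -- dimensions
  have hB3 : B.dim = 3 := by rw [dim_eq_of_isCMTypeRealisation hB, h6]
  have hE1 : E.dim = 1 := by rw [dim_eq_of_isCMTypeRealisation hE, h2]
  have hdim : (B ⊞ E).dim = 2 * 2 := by rw [AbelianVariety.dim_biprod, hB3, hE1]
  have hY : IsSmoothProjective (2 * 2) (B ⊞ E).X := isSmoothProjective_of_dim_eq' hdim
  -- eigenbases of the factors
  obtain ⟨v, hv⟩ := exists_eigenbasis hB
  obtain ⟨u, hu⟩ := exists_eigenbasis hE
  -- the embedding `τ₊` with `τ₊(δ) = i√d` and its three extensions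
  obtain ⟨τ, hτ⟩ := exists_apply_eq_I_mul_sqrt hδ
  set F : Finset (K →+* ℂ) := Finset.univ.filter fun s : K →+* ℂ => s.comp i = τ with hFdef
  have hF : F.card = 3 := card_filter_comp_eq_three i h6 h2 τ
  let e : Fin 3 ≃ {s // s ∈ F} := (F.equivFinOfCardEq hF).symm
  let sF : Fin 3 → (K →+* ℂ) := fun m => (e m).1
  have hsF : ∀ m, (sF m).comp i = τ := fun m => (Finset.mem_filter.mp (e m).2).2
  have hsF_inj : Function.Injective sF := Subtype.val_injective.comp e.injective
  -- the four eigenvectors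
  let xB : Fin 3 → complexBetti (B ⊞ E).X 1 := fun m =>
    complexBetti.map (biprod.fst : B ⊞ E ⟶ B).hom.hom.hom 1 (v (sF m))
  let xE : complexBetti (B ⊞ E).X 1 := complexBetti.map (biprod.snd : B ⊞ E ⟶ E).hom.hom.hom 1 (u τ)
  let w : Fin 4 → complexBetti (B ⊞ E).X 1 := Fin.cons xE xB
  -- eigenvectors of `φ_Y^*`
  have hvK : ∀ m, complexBetti.map (ιB δK).hom.hom.hom 1 (v (sF m)) = μ • v (sF m) := by
    intro m
    rw [map_ι_apply_of_mem_eigenline hB (hv (sF m)) δK]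
    congr 1
    rw [hδKdef, RingOfIntegers.mapRingHom_apply, ← RingHom.comp_apply, hsF m, hτ]
  have huk : complexBetti.map (ιE δ).hom.hom.hom 1 (u τ) = μ • u τ := by
    rw [map_ι_apply_of_mem_eigenline hE (hu τ) δ, hτ]
  have hw : ∀ j, w j ∈ Module.End.eigenspace (complexBetti.map φY.hom.hom.hom 1).hom μ := by
    intro j
    rw [Module.End.mem_eigenspace_iff]
    refine Fin.cases ?_ (fun m => ?_) j
    · change complexBetti.map φY.hom.hom.hom 1 xE = μ • xE
      rw [hφYdef, map_biprodMap_map_snd, huk, map_smul]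
    · change complexBetti.map φY.hom.hom.hom 1 (xB m) = μ • xB m
      rw [hφYdef, map_biprodMap_map_fst, hvK, map_smul]
  -- linear independence
  have hli : LinearIndependent ℂ w := by
    rw [Fintype.linearIndependent_iff]
    intro g hg
    rw [Fin.sum_univ_succ] at hg
    simp only [w, Fin.cons_zero, Fin.cons_succ] at hg
    -- project to `B`
    have h1 := congrArg (complexBetti.map (biprod.inl : B ⟶ B ⊞ E).hom.hom.hom 1) hg
    rw [map_add, map_smul, map_sum, map_zero, map_inl_map_snd, smul_zero, zero_add] at h1
    have h1' : ∑ m : Fin 3, g m.succ • v (sF m) = 0 := by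
      rw [← h1]
      refine Finset.sum_congr rfl fun m _ => ?_
      rw [map_smul, map_inl_map_fst]
    have hv3 : LinearIndependent ℂ (fun m : Fin 3 => v (sF m)) := v.linearIndependent.comp sF hsF_inj
    have hg' : ∀ m : Fin 3, g m.succ = 0 := Fintype.linearIndependent_iff.mp hv3 (fun m => g m.succ) h1'
    -- project to `E`
    have h2' := congrArg (complexBetti.map (biprod.inr : E ⟶ B ⊞ E).hom.hom.hom 1) hg
    rw [map_add, map_smul, map_sum, map_zero, map_inr_map_snd] at h2'
    have hsum0 : ∑ m : Fin 3, complexBetti.map (biprod.inr : E ⟶ B ⊞ E).hom.hom.hom 1 (g m.succ • xB m) = 0 :=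
      Finset.sum_eq_zero fun m _ => by rw [map_smul, map_inr_map_fst, smul_zero]
    rw [hsum0, add_zero] at h2'
    have hg0 : g 0 = 0 := by
      rcases smul_eq_zero.mp h2' with h | h
      · exact h
      · exact absurd h (u.ne_zero τ)
    intro j
    exact Fin.cases hg0 hg' j
  -- Hodge types
  let p : Fin 4 → ℕ := Fin.cons (if τ ∈ Φ₀.1 then 1 else 0) fun m => if sF m ∈ Ψ.1 then 1 else 0
  let q : Fin 4 → ℕ := Fin.cons (if τ ∈ Φ₀.1 then 0 else 1) fun m => if sF m ∈ Ψ.1 then 0 else 1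
  have hpq : ∀ j, IsOfHodgeType (2 * 2) (B ⊞ E).X 1 (p j) (q j) (w j) := by
    intro j
    refine Fin.cases ?_ (fun m => ?_) j
    · change IsOfHodgeType (2 * 2) (B ⊞ E).X 1 (if τ ∈ Φ₀.1 then 1 else 0) (if τ ∈ Φ₀.1 then 0 else 1) xE
      by_cases hτΦ : τ ∈ Φ₀.1
      · rw [if_pos hτΦ, if_pos hτΦ]
        exact (isOfHodgeType_oneZero_of_mem hE (hu τ) hτΦ).map_of_isSmoothProjective hY
          AbelianVariety.isSmoothProjective_holds _
      · rw [if_neg hτΦ, if_neg hτΦ]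
        exact (isOfHodgeType_zeroOne_of_not_mem hE (hu τ) hτΦ).map_of_isSmoothProjective hY
          AbelianVariety.isSmoothProjective_holds _
    · change IsOfHodgeType (2 * 2) (B ⊞ E).X 1 (if sF m ∈ Ψ.1 then 1 else 0) (if sF m ∈ Ψ.1 then 0 else 1) (xB m)
      by_cases hsΨ : sF m ∈ Ψ.1
      · rw [if_pos hsΨ, if_pos hsΨ]
        exact (isOfHodgeType_oneZero_of_mem hB (hv (sF m)) hsΨ).map_of_isSmoothProjective hY
          AbelianVariety.isSmoothProjective_holds _
      · rw [if_neg hsΨ, if_neg hsΨ]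
        exact (isOfHodgeType_zeroOne_of_not_mem hB (hv (sF m)) hsΨ).map_of_isSmoothProjective hY
          AbelianVariety.isSmoothProjective_holds _
  -- the count
  have hsumB : ∑ m : Fin 3, (if sF m ∈ Ψ.1 then 1 else 0 : ℕ) =
      (Finset.univ.filter fun s : K →+* ℂ => s.comp i = τ ∧ s ∈ Ψ.1).card := by
    have h1 : ∑ m : Fin 3, (if sF m ∈ Ψ.1 then 1 else 0 : ℕ) =
        ∑ s ∈ F, (if s ∈ Ψ.1 then 1 else 0 : ℕ) := by
      rw [← Finset.sum_coe_sort F, ← Fintype.sum_equiv e (fun m => (if sF m ∈ Ψ.1 then 1 else 0 : ℕ))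
        (fun s => (if (s : K →+* ℂ) ∈ Ψ.1 then 1 else 0 : ℕ)) (fun m => rfl)]
    rw [h1, Finset.sum_boole, Nat.cast_id, hFdef, Finset.filter_filter]
  have hp : ∑ j, p j = 2 := by
    rw [Fin.sum_univ_succ]
    simp only [p, Fin.cons_zero, Fin.cons_succ]
    rw [hsumB, add_comm]
    exact hcount τ
  have hpq1 : ∀ j, p j + q j = 1 := by
    intro j
    refine Fin.cases ?_ (fun m => ?_) j
    · change (if τ ∈ Φ₀.1 then 1 else 0) + (if τ ∈ Φ₀.1 then 0 else 1) = 1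
      split_ifs <;> rfl
    · change (if sF m ∈ Ψ.1 then 1 else 0) + (if sF m ∈ Ψ.1 then 0 else 1) = 1
      split_ifs <;> rfl
  have hq : ∑ j, q j = 2 := by
    have h := Finset.sum_add_distrib (s := Finset.univ) (f := p) (g := q)
    rw [Finset.sum_congr rfl fun j _ => hpq1 j, Finset.sum_const, Finset.card_univ, Fintype.card_fin,
      smul_eq_mul, mul_one, hp] at h
    omega
  exact isWeilType_of_cupPowOne φY (m := 2) two_pos hd hdim hφY w hli hw p q hpq hp hq

/-- **The whole Weil plane of the CM fourfold `B ⊞ E` is algebraic, given Markman's theorem** (A1-BLUEPRINT step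
L3, input of the pull-back step L5): in the situation of `isWeilType_cmThreefold_biprod_cmCurve`,
`weilClassesOf (B ⊞ E) φ_Y 2 d ≤ algebraicClasses (B ⊞ E).X 2` — Weil type upgrades the pointwise Markman input
`weilClasses_algebraic_cmThreefold_biprod_cmCurve` to the complex plane (van Geemen 4.9).  CONDITIONAL on the named
fact `Markman2025_weilClasses_algebraic_abelianFourfold`.
[cite: Markman2025SurveySecant, Thm. 1.2 and §11.5 Step 2] [cite: vanGeemen1994HodgeAV, 4.9–4.10] -/
theorem weilClassesOf_le_algebraicClasses_cmThreefold_biprod_cmCurve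
    (hW4 : Markman2025_weilClasses_algebraic_abelianFourfold)
    (h6 : Module.finrank ℚ K = 6) (h2 : Module.finrank ℚ k = 2) (i : k →+* K)
    {Ψ : CMType K} {B : AbelianVariety ℂ} {ιB : 𝓞 K →+* End B} {θB : K →+* Module.End ℂ (complexBetti B.X 1)}
    (hB : IsCMTypeRealisation Ψ B ιB θB)
    {Φ₀ : CMType k} {E : AbelianVariety ℂ} {ιE : 𝓞 k →+* End E} {θE : k →+* Module.End ℂ (complexBetti E.X 1)}
    (hE : IsCMTypeRealisation Φ₀ E ιE θE)
    {δ : 𝓞 k} {d : ℕ} (hd : 0 < d) (hδ : ((δ : k)) ^ 2 = -(d : k))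
    (hcount : ∀ τ : k →+* ℂ,
      (Finset.univ.filter fun s : K →+* ℂ => s.comp i = τ ∧ s ∈ Ψ.1).card + (if τ ∈ Φ₀.1 then 1 else 0) = 2) :
    weilClassesOf (B ⊞ E) (biprod.map (ιB (RingOfIntegers.mapRingHom i δ)) (ιE δ)) 2 d ≤
      algebraicClasses (B ⊞ E).X 2 := by
  have hδ𝓞 : δ ^ 2 = -(d : 𝓞 k) := by
    apply RingOfIntegers.ext
    change algebraMap (𝓞 k) k (δ ^ 2) = algebraMap (𝓞 k) k (-(d : 𝓞 k))
    rw [map_pow, map_neg, map_natCast]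
    exact hδ
  have hδK𝓞 : (RingOfIntegers.mapRingHom i δ) ^ 2 = -(d : 𝓞 K) := by
    rw [← map_pow, hδ𝓞, map_neg, map_natCast]
  refine (isWeilType_cmThreefold_biprod_cmCurve h6 h2 i hB hE hd hδ hcount).weilClassesOf_le_algebraicClasses
    fun c hcW hcQ hcH => ?_
  exact weilClasses_algebraic_cmThreefold_biprod_cmCurve hW4 h6 h2 hB hE hd hδK𝓞 hδ𝓞 c hcQ hcH hcW

end CM

end Summit.HodgeConjecture.CorCM.WeilFourfold
end
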